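import Literature.Analysis.FluidPDE.LongTimeAverageNonneg
import HarnessLib

/-!
# Long-time averages: sliding windows, comparison under domination, eventual bounds

Generic bookkeeping for the running time means `timeMean g T = T⁻¹ ∫₀ᵀ g` and the `limsup`
long-time averages `longTimeAvgSup g = limsup_{T → ∞} timeMean g T` of
`Literature.Analysis.FluidPDE.TurbWave0` (Doering–Foias 2002, §2), as needed when a quantity
observed through a *sliding window* `s ↦ ∫_{(s, s+c)} φ` is averaged over the window position `s`:

* `setLIntegral_Ioo_add_right` / `setLIntegral_Ioo_add_left` / `ae_restrict_Ioo_add_left` —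
  translation of lower integrals and of a.e. statements over intervals
  (`∫⁻_{(a,b)} φ(s + τ) dτ = ∫⁻_{(s+a,s+b)} φ`);
* `lintegral_window_le` (Tonelli) — the **sliding-window bound**
  `∫⁻_{(0,T)} ∫⁻_{(0,c)} φ(s + τ) dτ ds ≤ c · ∫⁻_{(0,T+c)} φ` for measurable `φ ≥ 0`, and its
  version `lintegral_window_le_of_aemeasurable` for `φ` merely a.e.-measurable on `(0, ∞)` (the two
  sides only see `φ` on `(0, ∞)`, so a measurable modification may be substituted);
* measurability of the window integral in the window position (`measurable_lintegral_window`,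
  `aemeasurable_lintegral_window`), finiteness and integrability of its real part
  (`lintegral_lintegral_window_lt_top`, `integrableOn_toReal_window`) and the real / running-mean
  forms of the sliding-window bound (`setIntegral_toReal_window_le`, `timeMean_toReal_window_le`:
  `⟨∫_{(s,s+c)} φ⟩_T ≤ c (T+c)/T · ⟨φ⟩_{T+c}`);
* comparison of running means under pointwise domination `0 ≤ D ≤ B` with `B` integrable,
  *including the junk case* of a non-integrable `D` (whose Bochner mean is `0`)
  (`setIntegral_Ioc_le_of_nonneg_of_le` — deprecated alias of Mathlib's `setIntegral_mono_of_nonneg` —,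
  `timeMean_le_timeMean_of_nonneg_of_le`);
* `longTimeAvgSup_le_of_eventually_le` — an eventual bound on the running means of a nonnegative
  function bounds its `limsup` average (coboundedness is automatic from `g ≥ 0`);
* `eventually_shift_le_limsup_add` — for an eventually bounded `m`, `m (T + c) ≤ limsup m + δ`
  eventually in `T`.

All statements are elementary measure theory (Tonelli, translation invariance of Lebesgue measure)
and order bookkeeping for Mathlib's real `Filter.limsup` (junk value `sInf ∅ = 0` for unbounded
families, whence the explicit `IsBoundedUnder` hypotheses). Nothing here is specific to fluids.

## Mathlib search

Used: `MeasureTheory.lintegral_lintegral_swap` (Tonelli), `Measurable.lintegral_prod_right`,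
`MeasureTheory.lintegral_add_right_eq_self`, `MeasureTheory.integral_toReal`, `ae_lt_top'`,
`integrable_toReal_of_lintegral_ne_top`, `Filter.limsup_le_of_le`, `Filter.eventually_lt_of_limsup_lt`,
`Filter.tendsto_atTop_add_const_right`. Mathlib has no sliding-window / moving-average lemma
(searched `window`, `moving`, `sliding`: none relevant).

## References

* C. R. Doering, C. Foias, *Energy dissipation in body-forced turbulence*, J. Fluid Mech. 467
  (2002), §2 (the running means `⟨·⟩_T` and their `lim sup`).
-/

noncomputable section

open MeasureTheory Set Filter Topology
open scoped ENNReal NNReal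

namespace Literature.Analysis.FluidPDE

/-! ### Translation of lower integrals over intervals -/

/-- Change of variables `t ↦ t + s` in a lower integral over an open interval:
`∫⁻_{(a,b)} φ(t + s) dt = ∫⁻_{(a+s,b+s)} φ` (translation invariance of Lebesgue measure). [folklore] -/
theorem setLIntegral_Ioo_add_right (φ : ℝ → ℝ≥0∞) (a b s : ℝ) :
    ∫⁻ t in Ioo a b, φ (t + s) = ∫⁻ t in Ioo (a + s) (b + s), φ t := by
  -- adapted from Literature/Analysis/FluidPDE/LerayHopfTranslate.lean (`setLIntegral_Ioo_comp_add_right`)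
  have h1 : ∀ t, (Ioo a b).indicator (fun t => φ (t + s)) t =
      (Ioo (a + s) (b + s)).indicator φ (t + s) := by
    intro t
    by_cases ht : t ∈ Ioo a b
    · rw [indicator_of_mem ht, indicator_of_mem (show t + s ∈ Ioo (a + s) (b + s) from
        ⟨by linarith [ht.1], by linarith [ht.2]⟩)]
    · rw [indicator_of_notMem ht, indicator_of_notMem]
      rintro ⟨h₁, h₂⟩
      exact ht ⟨by linarith, by linarith⟩
  rw [← lintegral_indicator measurableSet_Ioo, ← lintegral_indicator measurableSet_Ioo]
  calc ∫⁻ t, (Ioo a b).indicator (fun t => φ (t + s)) t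
      = ∫⁻ t, (Ioo (a + s) (b + s)).indicator φ (t + s) := lintegral_congr h1
    _ = ∫⁻ t, (Ioo (a + s) (b + s)).indicator φ t :=
        lintegral_add_right_eq_self (μ := (volume : Measure ℝ)) _ s

/-- Change of variables `t ↦ s + t` in a lower integral over an open interval:
`∫⁻_{(a,b)} φ(s + t) dt = ∫⁻_{(s+a,s+b)} φ` — the window `(s, s + c)` seen from its left end. [folklore] -/
theorem setLIntegral_Ioo_add_left (φ : ℝ → ℝ≥0∞) (a b s : ℝ) :
    ∫⁻ t in Ioo a b, φ (s + t) = ∫⁻ t in Ioo (s + a) (s + b), φ t := by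
  simp_rw [add_comm s]
  exact setLIntegral_Ioo_add_right φ a b s

/-- Transport of an a.e. statement on an interval along `t ↦ s + t`: if `P` holds a.e. on
`(s + a, s + b)` then `P (s + ·)` holds a.e. on `(a, b)` (translation invariance of Lebesgue
measure; the `t + s` twin is `ae_restrict_Ioo_comp_add_right` of `LerayHopfTranslate`). [folklore] -/
theorem ae_restrict_Ioo_add_left {a b : ℝ} (s : ℝ) {P : ℝ → Prop}
    (h : ∀ᵐ t ∂(volume.restrict (Ioo (s + a) (s + b))), P t) :
    ∀ᵐ t ∂(volume.restrict (Ioo a b)), P (s + t) := by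
  -- adapted from Literature/Analysis/FluidPDE/LerayHopfTranslate.lean (`ae_restrict_Ioo_comp_add_right`)
  rw [ae_restrict_iff' measurableSet_Ioo] at h ⊢
  have h2 := (measurePreserving_add_left volume s).quasiMeasurePreserving.ae h
  filter_upwards [h2] with t ht hts
  exact ht ⟨by linarith [hts.1], by linarith [hts.2]⟩

/-- Two integrands that agree a.e. on `(0, ∞)` have the same integral over every window
`(s, s + c)` with `s ≥ 0`. [folklore] -/
theorem lintegral_window_congr_ae {φ φ' : ℝ → ℝ≥0∞} (h : φ =ᵐ[volume.restrict (Ioi 0)] φ')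
    {s : ℝ} (hs : 0 ≤ s) (c : ℝ) :
    ∫⁻ τ in Ioo 0 c, φ (s + τ) = ∫⁻ τ in Ioo 0 c, φ' (s + τ) := by
  rw [setLIntegral_Ioo_add_left, setLIntegral_Ioo_add_left]
  refine lintegral_congr_ae (ae_restrict_of_ae_restrict_of_subset ?_ h)
  intro t ht
  have h1 : s + 0 < t := ht.1
  exact hs.trans_lt (by linarith)

/-! ### The sliding-window bound (Tonelli) -/

/-- **Sliding-window bound.** For a measurable `φ : ℝ → [0, ∞]`,
`∫⁻_{s ∈ (0,T)} ∫⁻_{τ ∈ (0,c)} φ(s + τ) ≤ c₊ · ∫⁻_{(0, T + c)} φ`: swap the integrals (Tonelli),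
translate the inner one to `(τ, T + τ) ⊆ (0, T + c)`, and integrate the constant bound over
`τ ∈ (0, c)` (both sides vanish for `c ≤ 0`). [folklore] -/
theorem lintegral_window_le {φ : ℝ → ℝ≥0∞} (hφ : Measurable φ) (c T : ℝ) :
    ∫⁻ s in Ioo 0 T, ∫⁻ τ in Ioo 0 c, φ (s + τ) ≤
      ENNReal.ofReal c * ∫⁻ t in Ioo 0 (T + c), φ t := by
  have hmeas : AEMeasurable (Function.uncurry fun s τ : ℝ => φ (s + τ))
      ((volume.restrict (Ioo 0 T)).prod (volume.restrict (Ioo 0 c))) :=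
    (hφ.comp measurable_add).aemeasurable
  rw [lintegral_lintegral_swap hmeas]
  calc ∫⁻ τ in Ioo 0 c, ∫⁻ s in Ioo 0 T, φ (s + τ)
      ≤ ∫⁻ _ in Ioo 0 c, ∫⁻ t in Ioo 0 (T + c), φ t := by
        refine setLIntegral_mono' measurableSet_Ioo fun τ hτ => ?_
        rw [setLIntegral_Ioo_add_right φ 0 T τ, zero_add]
        exact lintegral_mono_set (Ioo_subset_Ioo hτ.1.le (by linarith [hτ.2]))
    _ = ENNReal.ofReal c * ∫⁻ t in Ioo 0 (T + c), φ t := by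
        rw [setLIntegral_const, Real.volume_Ioo, sub_zero, mul_comm]

/-- **Sliding-window bound, a.e.-measurable form.** The bound `lintegral_window_le` for `φ` merely
a.e.-measurable on `(0, ∞)` (both sides only evaluate `φ` on `(0, ∞)`, so `φ` may be replaced by a
measurable modification). [folklore] -/
theorem lintegral_window_le_of_aemeasurable {φ : ℝ → ℝ≥0∞}
    (hφ : AEMeasurable φ (volume.restrict (Ioi 0))) (c T : ℝ) :
    ∫⁻ s in Ioo 0 T, ∫⁻ τ in Ioo 0 c, φ (s + τ) ≤
      ENNReal.ofReal c * ∫⁻ t in Ioo 0 (T + c), φ t := by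
  have hR : ∫⁻ t in Ioo 0 (T + c), φ t = ∫⁻ t in Ioo 0 (T + c), hφ.mk φ t :=
    lintegral_congr_ae (ae_restrict_of_ae_restrict_of_subset Ioo_subset_Ioi_self hφ.ae_eq_mk)
  rw [setLIntegral_congr_fun measurableSet_Ioo
    (fun s hs => lintegral_window_congr_ae hφ.ae_eq_mk hs.1.le c), hR]
  exact lintegral_window_le hφ.measurable_mk c T

/-! ### Measurability and integrability of the window integral -/

/-- The window integral `s ↦ ∫⁻_{(0,c)} φ(s + τ) dτ` of a measurable `φ` is measurable in the window
position (Tonelli measurability, `Measurable.lintegral_prod_right`). [folklore] -/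
theorem measurable_lintegral_window {φ : ℝ → ℝ≥0∞} (hφ : Measurable φ) (c : ℝ) :
    Measurable fun s => ∫⁻ τ in Ioo 0 c, φ (s + τ) :=
  Measurable.lintegral_prod_right (ν := volume.restrict (Ioo 0 c)) (hφ.comp measurable_add)

/-- The window integral of a function a.e.-measurable on `(0, ∞)` is a.e.-measurable in the window
position `s ∈ (0, ∞)`. [folklore] -/
theorem aemeasurable_lintegral_window {φ : ℝ → ℝ≥0∞}
    (hφ : AEMeasurable φ (volume.restrict (Ioi 0))) (c : ℝ) :
    AEMeasurable (fun s => ∫⁻ τ in Ioo 0 c, φ (s + τ)) (volume.restrict (Ioi 0)) := by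
  refine (measurable_lintegral_window hφ.measurable_mk c).aemeasurable.congr ?_
  filter_upwards [ae_restrict_mem measurableSet_Ioi] with s hs
  exact (lintegral_window_congr_ae hφ.ae_eq_mk (le_of_lt hs) c).symm

/-- If `∫⁻_{(0,T+c)} φ < ∞` then the window integrals have finite integral over the window positions
`s ∈ (0, T)` (sliding-window bound). [folklore] -/
theorem lintegral_lintegral_window_lt_top {φ : ℝ → ℝ≥0∞}
    (hφ : AEMeasurable φ (volume.restrict (Ioi 0))) {c T : ℝ}
    (hfin : ∫⁻ t in Ioo 0 (T + c), φ t ≠ ∞) :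
    ∫⁻ s in Ioo 0 T, ∫⁻ τ in Ioo 0 c, φ (s + τ) < ∞ :=
  (lintegral_window_le_of_aemeasurable hφ c T).trans_lt
    (ENNReal.mul_lt_top ENNReal.ofReal_lt_top hfin.lt_top)

/-- If `∫⁻_{(0,T+c)} φ < ∞` then the real part of the window integral,
`s ↦ (∫⁻_{(0,c)} φ(s + τ) dτ).toReal`, is integrable over the window positions `s ∈ (0, T]`. [folklore] -/
theorem integrableOn_toReal_window {φ : ℝ → ℝ≥0∞}
    (hφ : AEMeasurable φ (volume.restrict (Ioi 0))) {c T : ℝ}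
    (hfin : ∫⁻ t in Ioo 0 (T + c), φ t ≠ ∞) :
    IntegrableOn (fun s => (∫⁻ τ in Ioo 0 c, φ (s + τ)).toReal) (Ioc 0 T) := by
  rw [integrableOn_Ioc_iff_integrableOn_Ioo]
  exact integrable_toReal_of_lintegral_ne_top
    ((aemeasurable_lintegral_window hφ c).mono_measure
      (Measure.restrict_mono Ioo_subset_Ioi_self le_rfl))
    (lintegral_lintegral_window_lt_top hφ hfin).ne

/-- **Sliding-window bound, real form.** If `φ` is a.e.-measurable on `(0, ∞)` with
`∫⁻_{(0,T+c)} φ < ∞`, `c ≥ 0`, then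
`∫_{s ∈ (0,T]} (∫⁻_{(0,c)} φ(s+τ) dτ).toReal ds ≤ c · ∫_{(0,T+c]} φ.toReal`. [folklore] -/
theorem setIntegral_toReal_window_le {φ : ℝ → ℝ≥0∞}
    (hφ : AEMeasurable φ (volume.restrict (Ioi 0))) {c : ℝ} (hc : 0 ≤ c) {T : ℝ}
    (hfin : ∫⁻ t in Ioo 0 (T + c), φ t ≠ ∞) :
    ∫ s in Ioc 0 T, (∫⁻ τ in Ioo 0 c, φ (s + τ)).toReal ≤ c * ∫ t in Ioc 0 (T + c), (φ t).toReal := by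
  have hWm : AEMeasurable (fun s => ∫⁻ τ in Ioo 0 c, φ (s + τ)) (volume.restrict (Ioo 0 T)) :=
    (aemeasurable_lintegral_window hφ c).mono_measure
      (Measure.restrict_mono Ioo_subset_Ioi_self le_rfl)
  have hWfin := lintegral_lintegral_window_lt_top hφ hfin
  have hφm : AEMeasurable φ (volume.restrict (Ioo 0 (T + c))) :=
    hφ.mono_measure (Measure.restrict_mono Ioo_subset_Ioi_self le_rfl)
  rw [integral_Ioc_eq_integral_Ioo, integral_Ioc_eq_integral_Ioo,
    integral_toReal hWm (ae_lt_top' hWm hWfin.ne), integral_toReal hφm (ae_lt_top' hφm hfin)]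
  calc (∫⁻ s in Ioo 0 T, ∫⁻ τ in Ioo 0 c, φ (s + τ)).toReal
      ≤ (ENNReal.ofReal c * ∫⁻ t in Ioo 0 (T + c), φ t).toReal :=
        ENNReal.toReal_mono (ENNReal.mul_ne_top ENNReal.ofReal_ne_top hfin)
          (lintegral_window_le_of_aemeasurable hφ c T)
    _ = c * (∫⁻ t in Ioo 0 (T + c), φ t).toReal := by
        rw [ENNReal.toReal_mul, ENNReal.toReal_ofReal hc]

/-- **Sliding-window bound for running means**: under the hypotheses of
`setIntegral_toReal_window_le` and `T > 0`,
`⟨(∫⁻_{(0,c)} φ(· + τ) dτ).toReal⟩_T ≤ c (T + c)/T · ⟨φ.toReal⟩_{T+c}` (`timeMean`). [folklore] -/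
theorem timeMean_toReal_window_le {φ : ℝ → ℝ≥0∞}
    (hφ : AEMeasurable φ (volume.restrict (Ioi 0))) {c : ℝ} (hc : 0 ≤ c) {T : ℝ} (hT : 0 < T)
    (hfin : ∫⁻ t in Ioo 0 (T + c), φ t ≠ ∞) :
    timeMean (fun s => (∫⁻ τ in Ioo 0 c, φ (s + τ)).toReal) T ≤
      c * (T + c) / T * timeMean (fun t => (φ t).toReal) (T + c) := by
  have hTc : 0 < T + c := by linarith
  simp only [timeMean, intervalIntegral.integral_of_le hT.le, intervalIntegral.integral_of_le hTc.le]
  have h := setIntegral_toReal_window_le hφ hc hfin (T := T)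
  calc T⁻¹ * ∫ s in Ioc 0 T, (∫⁻ τ in Ioo 0 c, φ (s + τ)).toReal
      ≤ T⁻¹ * (c * ∫ t in Ioc 0 (T + c), (φ t).toReal) :=
        mul_le_mul_of_nonneg_left h (inv_nonneg.2 hT.le)
    _ = c * (T + c) / T * ((T + c)⁻¹ * ∫ t in Ioc 0 (T + c), (φ t).toReal) := by
        field_simp

/-! ### Comparison of running means under domination (junk included) -/

/-- If `0 ≤ D ≤ B` on `(0, T]` and `B` is integrable there, then `∫_{(0,T]} D ≤ ∫_{(0,T]} B` —
also when `D` is *not* integrable (junk value `0 ≤ ∫ B`). This is Mathlib's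
`MeasureTheory.setIntegral_mono_of_nonneg` (any set/measure); kept as a deprecated alias
(librarian dedup-01558). [folklore] -/
@[deprecated MeasureTheory.setIntegral_mono_of_nonneg (since := "2026-08-16")]
alias setIntegral_Ioc_le_of_nonneg_of_le := MeasureTheory.setIntegral_mono_of_nonneg

/-- **Running means are monotone under domination, junk included**: if `0 ≤ D ≤ B` on `(0, T]`,
`T ≥ 0`, and `B` is integrable on `(0, T]`, then `⟨D⟩_T ≤ ⟨B⟩_T` (`timeMean`; a non-integrable `D`
has running mean `0`). [folklore] -/
theorem timeMean_le_timeMean_of_nonneg_of_le {D B : ℝ → ℝ} {T : ℝ} (hT : 0 ≤ T)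
    (hD : ∀ s ∈ Ioc 0 T, 0 ≤ D s) (hDB : ∀ s ∈ Ioc 0 T, D s ≤ B s) (hB : IntegrableOn B (Ioc 0 T)) :
    timeMean D T ≤ timeMean B T := by
  simp only [timeMean, intervalIntegral.integral_of_le hT]
  exact mul_le_mul_of_nonneg_left (setIntegral_mono_of_nonneg hD hDB hB) (inv_nonneg.2 hT)

/-! ### `limsup` bookkeeping -/

/-- An eventual bound on the running means of a pointwise nonnegative function bounds its `limsup`
long-time average: `(∀ᶠ T, ⟨g⟩_T ≤ R) → ⟨g⟩ ≤ R` (the running means are eventually `≥ 0`, which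
supplies the coboundedness Mathlib's real `limsup` needs). [folklore] -/
theorem longTimeAvgSup_le_of_eventually_le {g : ℝ → ℝ} {R : ℝ} (hg : ∀ t, 0 ≤ g t)
    (h : ∀ᶠ T in atTop, timeMean g T ≤ R) : longTimeAvgSup g ≤ R := by
  refine limsup_le_of_le (isCoboundedUnder_le_of_eventually_le (x := 0) atTop ?_) h
  filter_upwards [eventually_ge_atTop (0 : ℝ)] with T hT using timeMean_nonneg hg hT

/-- For an eventually bounded real function `m` on `atTop`, a shift `c` and `δ > 0`:
eventually `m (T + c) ≤ limsup m + δ` (`Filter.eventually_lt_of_limsup_lt` transported along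
`T ↦ T + c → +∞`). Without `IsBoundedUnder` the real `limsup` is the junk `0` and this fails. [folklore] -/
theorem eventually_shift_le_limsup_add {m : ℝ → ℝ} (hm : IsBoundedUnder (· ≤ ·) atTop m) (c : ℝ)
    {δ : ℝ} (hδ : 0 < δ) : ∀ᶠ T in atTop, m (T + c) ≤ limsup m atTop + δ := by
  have h : ∀ᶠ T in atTop, m T < limsup m atTop + δ := eventually_lt_of_limsup_lt (by linarith) hm
  exact (tendsto_atTop_add_const_right atTop c tendsto_id).eventually (h.mono fun T hT => hT.le)

end Literature.Analysis.FluidPDE
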